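import Literature.NumberTheory.Sieve.LargeGapsRateComparison
import HarnessLib

/-!
# Maynard 2016, §2 "The Erdős–Rankin construction": the parameters `y, z, U`, the sets `𝓡'`,
# `𝓡_m`, Lemmas 2–4 and Proposition 5 (named facts), and the PROVED deduction
# "cover `[1, U]` for every `C_U` ⇒ Theorem 1"

Topic `Literature/NumberTheory/Sieve`. This file TYPES the blocks of Maynard's proof of
`limsup (p_{n+1} − p_n)/R(p_n) = ∞` (J. Maynard, *Large gaps between primes*, Ann. of Math. 183
(2016) 915–933, arXiv:1408.5110, §2) as named facts with locators — the three independently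
claimable blocks of the ladder's Tier-2 seat plan (`LargeGapsBetweenPrimes.lean`;
memo ROUND-16 §4 (iii)): [M-a] `Lemma2` (the Maier–Pomerance count of `𝓡'`), [M-b] `Lemma3`
(fundamental lemma + Bombieri–Vinogradov) and `Lemma4` (its summed form), [M-c] `Proposition5`
(the modified Maynard–Tao sieve weights), plus [M-d] `Reduction` (the one-page "Proof of Theorem 1
assuming Proposition 5") — and PROVES the remaining printed sentence of §2:

  "By the Chinese remainder theorem, if we can cover `[1, U]` by the residue classes
  `a_p (mod p)` for `p ≤ x`, then … Letting `x = (1 − ε) log X`, we see that this would show there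
  is an interval in `[1, X]` of length `(1 − 2ε + o(1)) C_U (log X)(log₂ X)(log₄ X)(log₃ X)^{-2}`
  containing no primes. Therefore we immediately obtain Theorem 1 if we can take `C_U` to be
  arbitrarily large whilst still covering `[1, U]`" [Maynard2016LargeGaps, §2, p. 4]:

* `U_eq`: `U = C_U (1 − ε) · x log x log₃ x/(log₂ x)²` — Maynard's `U` is the Rankin covering
  length with constant `α = C_U (1 − ε)`;
* `rankinConstant_of_coveringGoal`: covering `[1, U]` for all large `x` (fixed `C_U, ε < 1`) gives
  `RankinConstant (C_U (1 − ε)/64)` (via `RankinTransfer.rankinConstant_of_cover`, which replaces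
  "`x = (1 − ε) log X`" by `x = ⌊log X/3⌋` and `P(x) ≤ 4ˣ` — constant `1/64` instead of `1 − ε`,
  immaterial since `C_U` is arbitrary);
* `forall_rankinConstant_of_coveringTheorem`, `theorem1_of_coveringTheorem`: **`CoveringTheorem`
  (cover `[1,U]` for every `C_U`) ⇒ every Rankin constant ⇒ `Maynard2016_theorem1`** (the last
  step is `maynard2016_theorem1_of_rankinConstant`, `LargeGapsRateComparison.lean`);
* `sievedPrimes_eq_empty_of_odd`: `𝓡_m = ∅` for odd `m` ("the condition `(mp − 1, P_y) = 1`
  requires that `m` be even"), a typing check of the coprimality encoding.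

Rendering conventions. `x : ℕ` (Maynard's `x`; residue classes for the primes `p ≤ x`);
`y, z, U : ℝ` as printed; "`ε` sufficiently small" is `∀ᶠ ε in 𝓝[>] 0`; "for `x > x₀(…)`" is
`∀ᶠ x in atTop` placed after the parameters `x₀` may depend on; `≪`/`O(·)` constants are
existentially quantified after the parameters they may depend on (`C_U, ε`); `(n, P_y) = 1` is
`Nat.Coprime n (primorial ⌊y⌋₊)`; "`y`-smooth" is `∀ p ∈ n.primeFactors, p ≤ ⌊y⌋₊`; "`p ≤ y`" for a
prime `p` is `p ≤ ⌊y⌋₊`. Ledger: 6 named facts (`Lemma2`, `Lemma3`, `Lemma4`, `Proposition5`,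
`Reduction`, `CoveringTheorem`), not proved here; `CoveringTheorem` follows from the other five
by modus ponens (`example` at the end), and implies `Maynard2016_theorem1` (PROVED here).

## References

* J. Maynard, *Large gaps between primes*, Ann. of Math. (2) 183 (2016), 915–933; arXiv:1408.5110.
  §2: (2.1) parameters, (2.2)–(2.6) the sets, Lemmas 2–4, Proposition 5, proof of Theorem 1
  assuming Proposition 5 (p. 4 of the arXiv version). [Maynard2016LargeGaps]
* H. Maier, C. Pomerance, *Unusually large gaps between consecutive primes*, Trans. Amer. Math.
  Soc. 322 (1990) 201–237 (source of Lemma 2). [MaierPomerance1990]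
-/

open Filter Finset
open scoped Topology

namespace Literature.NumberTheory.Sieve

namespace Maynard2016

/-! ### The parameters (2.1) -/

/-- `y = exp((1 − ε) log x log₃ x/log₂ x)`. [cite: Maynard2016LargeGaps, (2.1)] -/
noncomputable def y (ε : ℝ) (x : ℕ) : ℝ :=
  Real.exp ((1 - ε) * (Real.log x * Real.log (Real.log (Real.log x)) / Real.log (Real.log x)))

/-- `z = x/log₂ x`. [cite: Maynard2016LargeGaps, (2.1)] -/
noncomputable def z (x : ℕ) : ℝ := (x : ℝ) / Real.log (Real.log x)

/-- `U = C_U x log y/log₂ x`. [cite: Maynard2016LargeGaps, (2.1)] -/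
noncomputable def U (C_U ε : ℝ) (x : ℕ) : ℝ :=
  C_U * ((x : ℝ) * Real.log (y ε x) / Real.log (Real.log x))

/-- `log y = (1 − ε) log x log₃ x/log₂ x`. [cite: Maynard2016LargeGaps, (2.1)] -/
theorem log_y (ε : ℝ) (x : ℕ) :
    Real.log (y ε x) = (1 - ε) * (Real.log x * Real.log (Real.log (Real.log x)) /
      Real.log (Real.log x)) :=
  Real.log_exp _

/-- **`U` is the Rankin covering length with constant `C_U (1 − ε)`**:
`U = C_U (1 − ε) · x log x log₃ x/(log₂ x)²`. [cite: Maynard2016LargeGaps, (2.1)] -/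
theorem U_eq (C_U ε : ℝ) (x : ℕ) :
    U C_U ε x = C_U * (1 - ε) * ((x : ℝ) * Real.log x * Real.log (Real.log (Real.log x)) /
      (Real.log (Real.log x)) ^ 2) := by
  rw [U, log_y]; ring

/-! ### The sets (2.4)–(2.6) -/

/-- `𝓡' = {m ≤ U : m is y-smooth, (m − 1, P_y) = 1}` — what survives `a_p = 0 (y < p ≤ z)` and
`a_p = 1 (p ≤ y)` among the integers with no prime factor `> z`. [cite: Maynard2016LargeGaps, (2.5)] -/
noncomputable def Rprime (C_U ε : ℝ) (x : ℕ) : Finset ℕ :=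
  (Finset.Icc 1 ⌊U C_U ε x⌋₊).filter
    (fun n => (∀ p ∈ n.primeFactors, p ≤ ⌊y ε x⌋₊) ∧ Nat.Coprime (n - 1) (primorial ⌊y ε x⌋₊))

/-- The counting set of Lemma 3: `{z < p ≤ V : p prime, (mp − 1, P_y) = 1}`.
[cite: Maynard2016LargeGaps, Lemma 3] -/
noncomputable def sievedPrimes (ε : ℝ) (x : ℕ) (V : ℝ) (m : ℕ) : Finset ℕ :=
  (Finset.Icc 1 ⌊V⌋₊).filter
    (fun p => p.Prime ∧ z x < (p : ℝ) ∧ Nat.Coprime (m * p - 1) (primorial ⌊y ε x⌋₊))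

/-- `𝓡_m = {z < p ≤ U/m : (mp − 1, P_y) = 1}` (so that `𝓡 = ⋃_m m · 𝓡_m`).
[cite: Maynard2016LargeGaps, (2.6)] -/
noncomputable def Rm (C_U ε : ℝ) (x m : ℕ) : Finset ℕ :=
  sievedPrimes ε x (U C_U ε x / m) m

/-- The singular product `∏_{p ≤ y, p ∤ m} (p − 2)/(p − 1)` of Lemma 3.
[cite: Maynard2016LargeGaps, Lemma 3] -/
noncomputable def singProd (ε : ℝ) (x m : ℕ) : ℝ :=
  ∏ p ∈ (Finset.Iic ⌊y ε x⌋₊).filter (fun p => p.Prime ∧ ¬ p ∣ m), ((p : ℝ) - 2) / ((p : ℝ) - 1)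

/-- "Since `p > z` the condition `(mp − 1, P_y) = 1` requires that `m` be even": for odd `m` the
set `{z < p ≤ V : (mp − 1, P_y) = 1}` is empty (once `y, z ≥ 2`). PROVED — a check of the
coprimality encoding. [cite: Maynard2016LargeGaps, §2 (sentence before (2.6))] -/
theorem sievedPrimes_eq_empty_of_odd {ε : ℝ} {x : ℕ} {V : ℝ} {m : ℕ} (hy : 2 ≤ ⌊y ε x⌋₊)
    (hz : 2 ≤ z x) (hm : Odd m) : sievedPrimes ε x V m = ∅ := by
  rw [sievedPrimes, Finset.filter_eq_empty_iff]
  rintro p - ⟨hprime, hzp, hcop⟩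
  have hp2 : 2 < p := by exact_mod_cast (show (2 : ℝ) < p by linarith)
  have hpodd : Odd p := hprime.odd_of_ne_two (by omega)
  have h2 : 2 ∣ m * p - 1 := by obtain ⟨k, hk⟩ := hm.mul hpodd; omega
  have h2P : 2 ∣ primorial ⌊y ε x⌋₊ := by
    rw [primorial_eq_prod_primesLE]
    exact dvd_prod_of_mem _ (Nat.mem_primesLE.2 ⟨hy, Nat.prime_two⟩)
  have h21 := Nat.dvd_gcd h2 h2P
  rw [hcop.gcd_eq_one] at h21
  omega

/-- `𝓡_m = ∅` for odd `m` (for `y, z ≥ 2`). [cite: Maynard2016LargeGaps, §2 (sentence before (2.6))] -/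
theorem Rm_eq_empty_of_odd {C_U ε : ℝ} {x m : ℕ} (hy : 2 ≤ ⌊y ε x⌋₊) (hz : 2 ≤ z x)
    (hm : Odd m) : Rm C_U ε x m = ∅ :=
  sievedPrimes_eq_empty_of_odd hy hz hm

/-! ### Lemmas 2–4 and Proposition 5 (named facts) -/

/-- **Maynard 2016, Lemma 2** (= Maier–Pomerance): `|𝓡'| ≪ x/(log x)^{1+ε}` ("Our slightly
different choice of `U` does not affect the argument from [MaierPomerance]"). Named fact, not
proved here (block [M-a]). [cite: Maynard2016LargeGaps, Lemma 2] -/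
def Lemma2 : Prop :=
  ∀ C_U : ℝ, 0 < C_U → ∀ᶠ ε : ℝ in 𝓝[>] 0, ∃ K : ℝ, 0 < K ∧ ∀ᶠ x : ℕ in atTop,
    ((Rprime C_U ε x).card : ℝ) ≤ K * (x : ℝ) / (Real.log x) ^ (1 + ε)

/-- **Maynard 2016, Lemma 3** (first display): uniformly for `z + z/log x ≤ V ≤ x (log x)²` and
`m ≤ x`, `#{z < p ≤ V : (mp − 1, P_y) = 1} = (V − z)/log x · ∏_{p ≤ y, p ∤ m} (p−2)/(p−1) ·
(1 + O(exp(−(log₂ x)^{1/2})))` ("a 'fundamental lemma' sieve and the Bombieri–Vinogradov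
theorem"). Named fact, not proved here (block [M-b]). [cite: Maynard2016LargeGaps, Lemma 3] -/
def Lemma3 : Prop :=
  ∀ᶠ ε : ℝ in 𝓝[>] 0, ∃ K : ℝ, 0 < K ∧ ∀ᶠ x : ℕ in atTop, ∀ V : ℝ,
    z x + z x / Real.log x ≤ V → V ≤ (x : ℝ) * (Real.log x) ^ 2 → ∀ m : ℕ, 1 ≤ m → m ≤ x →
      |((sievedPrimes ε x V m).card : ℝ) - (V - z x) / Real.log x * singProd ε x m| ≤
        K * Real.exp (-(Real.log (Real.log x)) ^ ((1 : ℝ) / 2)) *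
          ((V - z x) / Real.log x * singProd ε x m)

/-- **Maynard 2016, Lemma 4** (the two "in particular" bounds):
`Σ_{U/(z (log₂ x)²) ≤ m < U/z} |𝓡_m| = o(x/log x)` and
`Σ_{1 ≤ m < U/(z (log₂ x)²)} |𝓡_m| = O(C_U x/log x)`. Named fact, not proved here
(block [M-b]). [cite: Maynard2016LargeGaps, Lemma 4] -/
def Lemma4 : Prop :=
  ∀ C_U : ℝ, 0 < C_U → ∀ᶠ ε : ℝ in 𝓝[>] 0,
    (∀ η : ℝ, 0 < η → ∀ᶠ x : ℕ in atTop,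
      (∑ m ∈ (Finset.range ⌈U C_U ε x / z x⌉₊).filter
          (fun m : ℕ => U C_U ε x / (z x * (Real.log (Real.log x)) ^ 2) ≤ m),
        ((Rm C_U ε x m).card : ℝ)) ≤ η * ((x : ℝ) / Real.log x)) ∧
    (∃ K : ℝ, 0 < K ∧ ∀ᶠ x : ℕ in atTop,
      (∑ m ∈ (Finset.range ⌈U C_U ε x / (z x * (Real.log (Real.log x)) ^ 2)⌉₊).filter
          (fun m : ℕ => 1 ≤ m),
        ((Rm C_U ε x m).card : ℝ)) ≤ K * (C_U * (x : ℝ) / Real.log x))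

/-- **Maynard 2016, Proposition 5** (the key proposition): "Fix `δ > 0`. Let
`m < U z⁻¹ (log₂ x)⁻²` be even and let `𝓘_m ⊆ [x/2, x]` be an interval of length at least
`δ |𝓡_m| log x`. Then for `x > x₀(δ, C_U)`, there exists a choice of residue classes `a_q (mod q)`
for each prime `q ∈ 𝓘_m` such that `p ∈ 𝓡_m ⇒ p ≡ a_q (mod q)` for some prime `q ∈ 𝓘_m`."
Named fact, not proved here (block [M-c], §§3–6 of the paper). [cite: Maynard2016LargeGaps, Proposition 5] -/
def Proposition5 : Prop :=
  ∀ C_U : ℝ, 0 < C_U → ∀ᶠ ε : ℝ in 𝓝[>] 0, ∀ δ : ℝ, 0 < δ → ∀ᶠ x : ℕ in atTop,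
    ∀ m : ℕ, 1 ≤ m → Even m → (m : ℝ) < U C_U ε x / (z x * (Real.log (Real.log x)) ^ 2) →
      ∀ A B : ℝ, (x : ℝ) / 2 ≤ A → B ≤ x →
        δ * (Rm C_U ε x m).card * Real.log x ≤ B - A →
          ∃ a : ℕ → ℕ, ∀ p ∈ Rm C_U ε x m,
            ∃ q : ℕ, q.Prime ∧ A ≤ (q : ℝ) ∧ (q : ℝ) ≤ B ∧ p ≡ a q [MOD q]

/-! ### The covering statement and the reduction -/

/-- «`[1, U]` is covered by one residue class per prime `p ≤ x`, for all large `x`» (fixed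
`C_U, ε`), in the ladder's vocabulary `ResidueClassesCover x ⌊U⌋`.
[cite: Maynard2016LargeGaps, §2 (first paragraph)] -/
def CoveringGoal (C_U ε : ℝ) : Prop :=
  ∀ᶠ x : ℕ in atTop, ResidueClassesCover x ⌊U C_U ε x⌋₊

/-- **The conclusion of §2**: "we can choose residue classes `a_p (mod p)` for all `p ≤ x` which
cover all of `[1, U]`, for any fixed choice of `C_U`" (and every sufficiently small `ε`). Named
fact, not proved here; it follows from `Lemma2`, `Lemma4`, `Proposition5` and `Reduction`.
[cite: Maynard2016LargeGaps, §2, proof of Theorem 1 (last sentence)] -/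
def CoveringTheorem : Prop :=
  ∀ C_U : ℝ, 0 < C_U → ∀ᶠ ε : ℝ in 𝓝[>] 0, CoveringGoal C_U ε

/-- **"Proof of Theorem 1 assuming Proposition 5"** (one page: disjoint intervals `𝓘_m ⊆ [x/2, x]`
of lengths `δ|𝓡_m| log x` exist for `δ` small compared with `C_U` by Lemma 4; Proposition 5 covers
each `𝓡_m`; Lemmas 2–4 leave `o(x/log x)` elements, covered one per prime in `[z, x/2]`): the
implication Lemma 2 ∧ Lemma 4 ∧ Proposition 5 ⇒ `CoveringTheorem`. Named fact, not proved here
(block [M-d]; it also uses the first two sievings `a_p = 0, 1` and the prime number theorem on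
`[z, x/2]`). [cite: Maynard2016LargeGaps, §2, proof of Theorem 1 assuming Proposition 5] -/
def Reduction : Prop := Lemma2 → Lemma4 → Proposition5 → CoveringTheorem

/-! ### PROVED: covering `[1, U]` for every `C_U` gives Theorem 1 -/

/-- **Covering ⇒ Rankin constant**: if `[1, U]` is covered for all large `x` (fixed `C_U > 0`,
`ε < 1`), then `G(X) ≥ (C_U (1 − ε)/64 − ε') R(X)` for all large `X`. PROVED ("Letting
`x = (1 − ε) log X`, we see that this would show there is an interval in `[1, X]` of length
`(1 − 2ε + o(1)) C_U R(X)` containing no primes"; our transfer loses `1/64` instead of `1 − ε`).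
[cite: Maynard2016LargeGaps, §2 (paragraph after (2.1))] -/
theorem rankinConstant_of_coveringGoal {C_U ε : ℝ} (hC : 0 < C_U) (hε : ε < 1)
    (h : CoveringGoal C_U ε) : RankinConstant (C_U * (1 - ε) / 64) := by
  have hα : 0 < C_U * (1 - ε) := mul_pos hC (by linarith)
  refine RankinTransfer.rankinConstant_of_cover hα ?_
  filter_upwards [h] with x hx
  rwa [U_eq] at hx

/-- **`CoveringTheorem` ⇒ every Rankin constant** ("we immediately obtain Theorem 1 if we can take
`C_U` to be arbitrarily large whilst still covering `[1, U]`"). PROVED.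
[cite: Maynard2016LargeGaps, §2 (paragraph after (2.1))] -/
theorem forall_rankinConstant_of_coveringTheorem (h : CoveringTheorem) (c : ℝ) :
    RankinConstant c := by
  have hC : (0 : ℝ) < 64 * (2 * (max c 0 + 1)) := by positivity
  have hsmall : ∀ᶠ ε : ℝ in 𝓝[>] 0, ε < 1 / 2 :=
    eventually_nhdsWithin_of_eventually_nhds (eventually_lt_nhds (by norm_num))
  obtain ⟨ε, hcov, hε⟩ := ((h _ hC).and hsmall).exists
  have hR := rankinConstant_of_coveringGoal hC (by linarith) hcov
  refine hR.mono ?_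
  have e : 64 * (2 * (max c 0 + 1)) * (1 - ε) / 64 = 2 * (max c 0 + 1) * (1 - ε) := by ring
  rw [e]
  nlinarith [le_max_left c 0, le_max_right c 0]

/-- **`CoveringTheorem` ⇒ Maynard 2016, Theorem 1** (`limsup (p_{n+1} − p_n)/R(p_n) = ∞`).
PROVED (through every Rankin constant and `maynard2016_theorem1_of_rankinConstant`).
[cite: Maynard2016LargeGaps, Theorem 1 and §2] -/
theorem theorem1_of_coveringTheorem (h : CoveringTheorem) : Maynard2016_theorem1 :=
  maynard2016_theorem1_of_rankinConstant (forall_rankinConstant_of_coveringTheorem h)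

/-- The block structure closes: [M-a] `Lemma2`, [M-b] `Lemma4`, [M-c] `Proposition5` and
[M-d] `Reduction` together give Theorem 1 (kernel modus ponens + the PROVED final step).
[folklore] -/
example (h2 : Lemma2) (h4 : Lemma4) (h5 : Proposition5) (hred : Reduction) :
    Maynard2016_theorem1 :=
  theorem1_of_coveringTheorem (hred h2 h4 h5)

/-- … and also FGKT's `G(X)`-form with every constant (Pintz's `2e^γ`, Rankin's `1/3`).
[folklore] -/
example (h2 : Lemma2) (h4 : Lemma4) (h5 : Proposition5) (hred : Reduction) :
    Pintz1997_largeGaps :=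
  pintz1997_of_rankinConstant (forall_rankinConstant_of_coveringTheorem (hred h2 h4 h5))

end Maynard2016

end Literature.NumberTheory.Sieve
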